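import Summits.QuantumFields.YangMills.Theorems.BalabanUVNodesC44IterMhFramedCauchy
import Literature.MathematicalPhysics.QuantumFieldTheory.Balaban1983to89.Node00.BgLettersPrOfRecord
import HarnessLib

/-!
# (ℓa-C) ROAD B, FRAMED EDITION (ρ-frame-min), FILE F5ᵖʳ — THE RECORD INSTANCE: node00-def-Y's letter `Prop4LetterCPrAtRecord` ((A3) ✓`Node00.BgLettersPrOfRecord`) for the FRAMED
# remainder `C^{sl,pr}` at `(C₂, c₄) = (3.2·10¹⁶·L·N, (2·10¹¹·L·N)⁻¹)`, SMALL-FIELD APPROXIMATION, from F5's loop profile AND TWO DISPLAYED FRAME BOUNDS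

Cell `pub-ymgap` ∕ `ym-nodeO-ideate`, porter lineage `ymgap-nodeO-port-PTB-1` (gen 9); re-press (B) of director-ym g23 №608 — the one CONTENT item of PT-B's re-press list (F5
✓`…C44IterMhAtRecord` re-run on the framed chart of F2′ᵖʳ∕F4′-0ᵖʳ ✓`…C44IterMhFramedCauchy`), filed behind the ACCEPT of node00-def-Y's (A3); `--kind proof --supports
stmt-QuantumFields-27238 --as helper`; count-neutral; NEW basename, append-nothing.  [B7] = [Balaban1985Averaging]; [B11] = [Balaban1985Variational]; [I] = [Balaban1987RG1].

THE LETTER ((A3) ✓`Node00.BgLettersPrOfRecord`): `Prop4LetterCPrAtRecord F N K k Ω U₀ 𝔥 levB C₂ c₄ := Prop4Hyp (CslprOfRecord F N K k Ω U₀ 𝔥 levB) C₂ c₄` — for every `A′` of the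
space (115) with `‖A′‖ < c₄`: `‖C^{sl,pr}(A′)‖ ≤ C₂‖A′‖²`, and `C^{sl,pr}` ℂ-differentiable on that ball; `C^{sl,pr}(A′) = (1/i)log(Ū^{pr}(e^{iη_k·PA′}U₀)·Ū^k(U₀)⋆) − Q^{pr}_k(U₀)(η_k·PA′)`
with output weights `(L^jη)^0`, `P` the traceless projection.  HERE at `(C₂, c₄) = (3.2·10¹⁶·L·N, (2·10¹¹·L·N)⁻¹)` (k-FREE; `L, N`, `d = 4` only), UNDER F5's hypotheses VERBATIM
— the (0.4) guard of `U₀` below `k`; a LOOP PROFILE `ε` of the real tower (`‖Ū^j(U₀)(loop) − 1‖ ≤ ε_j`, `ε_j ≤ 1∕50`, `N·ε_j ≤ 2`, `3·10⁵·Σ_{j<k}ε_j ≤ 1∕4`); the TOP-LEVEL PROFILE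
`∀ x, x ∈ Ω_k` — AND TWO DISPLAYED FRAME BOUNDS on the traceless scaled polydisc `L^k‖Y‖ < ρ₀ = (2.5·10¹⁰·L·N)⁻¹`: (hdom) `e^{iY}U₀ ∈ 𝔥.dom`; (hnear) at every coarse site
`‖h(e^{iY}U₀)(y) − 1‖ ≤ c_𝔥·L^k‖Y‖` and `‖h⁻¹(e^{iY}U₀)(y) − 1‖ ≤ c_𝔥·L^k‖Y‖` with `c_𝔥 ≤ 10³` — the shape of [B7] (82)–(87) pp.30–31 ∕ (101)–(106) p.33 for the hierarchical frame
(`R̄ = exp[Σ L^{-d} log(…)]` is within `O(1)·(field size)` of `1`), to be DISCHARGED for (A1) `hierFrameDatumOfRecord` when node00-def-Y lands it; at `FrameDatum.frameless` they hold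
with `c_𝔥 = 0` and the theorem is F5 with a weaker constant.

PROOF.  F5 re-run.  For `‖A′‖ < c₄`, `X := η_k·ev(PA′)` is traceless with `L^k‖X‖ ≤ 2‖A′‖` (F5 ✓`norm_scaled_evLit_slProjLit_le`).  F4′'s package (`polydiscPackage_of_loopProfile` =
F5's inline block made a lemma: loops within `½` below `k`, `‖Ū_h(e^{iY}U₀)Ū₀⋆ − 1‖ ≤ 8000·L^k‖Y‖` at `k`) ⊗ the frame bounds give `‖Ū^{pr}(e^{iY}U₀)Ū₀⋆ − 1‖ ≤ 2·10⁴·L^k‖Y‖`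
(✓`norm_avPrM_mul_star_sub_one_le`: `(1+θ)(1+δ)(1+θ) − 1 ≤ 2(2θ+δ)`), hence `‖G^{pr}Y‖ ≤ 4·10⁴·L^k‖Y‖` ([B7] (26)) and analyticity of `G^{pr}` at `Y` (✓`analyticAt_framedLogChart`);
F4′-0ᵖʳ ✓`norm_framedLogChart_sub_qPrCplxOp_le_of_linearBound` yields `‖G^{pr}X − L^k·Q^{pr}X‖ ≤ (8·4·10⁴∕ρ₀)(L^k‖X‖)² ≤ 3.2·10¹⁶·L·N·‖A′‖²`; the components of `C^{sl,pr}(A′)` ARE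
those of `G^{pr}X − L^k·Q^{pr}X` (`equiv_CslprOfRecord_eq`, `L^kη_k = 1`); analyticity of `C^{sl,pr}` = def-Y ✓`analyticAt_CprOfRecord` ∘ `P` with the same letters.

WHAT IS PROVED (0 def, 0 sorry, axioms standard; ns `Summit.QuantumFields.YangMills.Theorems.C44IterMh`):
* `equiv_CslprOfRecord_eq`; ★ `polydiscPackage_of_loopProfile` (frame-free; F5's package as a named lemma); ★ `norm_avPrM_expOver_mul_star_sub_one_le_of_loopProfile`;
* ★★★ `prop4LetterCPrAtRecord_of_loopProfile` — THE FRAMED (ℓa-C) LETTER at `(C₂, c₄) = (3.2·10¹⁶·L·N, (2·10¹¹·L·N)⁻¹)` for EVERY datum `𝔥` carrying (hdom)∕(hnear).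

HONEST FRAMING.  (ℓa-C)ᵖʳ is DISCHARGED here ONLY in the small-field approximation (`Ω_k = T`), under the displayed summable loop profile, and MODULO the two displayed frame bounds
(hdom)∕(hnear) — proved here for NO non-trivial frame (no frame is constructed in the tree yet; (A1) is node00-def-Y's); constants crude; (ℓa-H)ᵖʳ, (ℓd)ᵖʳ DISPLAYED; (R1)∕(R2)
OPEN; K0ᴬ ⟨stmt-QuantumFields-27238⟩ NOT closed; K0ᴬ∕K1ᴬ∕K3ᴬ 0∕3; NODE O 0∕1; COUNT 8∕28 · K 1∕4 UNMOVED; finite `𝕋⁴_{L^K}` at fixed ε — NOT continuum ∕ ℝ⁴ ∕ OS ∕ Clay;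
**the Yang–Mills mass gap (Clay) is NOT proved by any of this.**  No `sorry`, `instance`, `notation`, `set_option`; standard axioms.
-/

noncomputable section

open scoped Matrix Matrix.Norms.L2Operator InnerProductSpace ComplexConjugate Topology

namespace Summit.QuantumFields.YangMills.Theorems.C44IterMh

open Literature.MathematicalPhysics.QuantumFieldTheory.Balaban1983to89
open Literature.MathematicalPhysics.QuantumFieldTheory.Balaban1983to89.Node00
open BlockAveraging
open B15AveragingHolomorphic (iterMh loopMh differentiableAt_iterMh coeField_iter_eq_iterMh)
open ExpMeanLog (expMeanLogSU)
open T4Continuum BlockAveraging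
open B11Eq115Space (NegSup NegSize levWeight levWeight_apply)
open NormedSpace (exp)
open Filter Metric Set
open Literature.Analysis.Complex (norm_sub_sub_le_of_forall_mem_ball)
open MatrixLog (mlog)

/-! ## The framed (44) ∕ (ℓa-C) letter AT THE RECORD from a loop profile and two displayed frame bounds -/

section RecordPr

variable (F : T4Family) (N : ℕ) [NeZero N] {K : ℕ} (k : ℕ) (Ω : ℕ → Set (Site (F.P K) 0)) (U₀ : GaugeField (F.P K) 0 (SU N))

/-- The framed remainder on the slice, unfolded at a bond against the scaled chart field `X = η_k·P A′` (`L^kη_k = 1` turns `Q^{pr}(evLit ·)` into `L^k•Q^{pr}X`).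
[cite: Balaban1985Variational, (44) p.285 (bookkeeping); Balaban1985Averaging, (92) p.31] -/
theorem equiv_CslprOfRecord_eq [Fact (0 < (F.L : ℝ))] [Fact (0 < (F.P K).eta k)] (𝔥 : FrameDatum (F.P K) N k U₀) (levB : PBond (F.P K) k → ℕ)
    (A : Space115Lit F N K k Ω U₀) (c : PBond (F.P K) k) :
    NegSup.equiv _ _ (CslprOfRecord F N K k Ω U₀ 𝔥 levB A) c =
      (logOver (coeField (Averaging.iter (fun j => blockAvg (P := F.P K) (j := j) expMeanLogSU) k U₀))
          (avPrM 𝔥 (expOver U₀ ((((F.P K).eta k : ℝ) : ℂ) • evLit F N K k Ω U₀ (slProjLit F N K k Ω U₀ A))))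
        - ((F.P K).L : ℂ) ^ k • qPrCplxOp k U₀ 𝔥 ((((F.P K).eta k : ℝ) : ℂ) • evLit F N K k Ω U₀ (slProjLit F N K k Ω U₀ A))) c := by
  rw [CslprOfRecord_apply, CprOfRecord_apply, Pi.sub_apply, logOver_apply, coeField_apply, Pi.smul_apply, map_smul, Pi.smul_apply, smul_smul, L_pow_mul_eta_cast F k,
    one_smul]
  rfl

/-- **F4′'s POLYDISC PACKAGE ON THE TRACELESS SCALED POLYDISC** `L^k‖Y‖ < ρ₀ = (2.5·10¹⁰·L·N)⁻¹` from the loop profile of the real tower (F5's inline package, now a lemma;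
frame-free): the holomorphic loops of `e^{iY}U₀` stay within `½` of `1` at every level `< k` (✓`norm_loopMh_iterMh_expOver_sub_one_le`) and
`‖Ū_h(e^{iY}U₀)(c)·Ū₀(c)⋆ − 1‖ ≤ 8000·L^k‖Y‖` at level `k` (✓`norm_iterMh_expOver_mul_star_sub_one_le`, `d = 4`).
[cite: Balaban1985Averaging, Proposition 3 p.36, Proposition 7 p.43; Balaban1985Variational, (51)–(53) p.286; Balaban1987RG1, (0.8) p.253] -/
theorem polydiscPackage_of_loopProfile (hU₀ : SmallBelow (avOfRecord F N K) k U₀)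
    (εs : ℕ → ℝ) (hε0 : ∀ j, 0 ≤ εs j)
    (hε : ∀ j, j < k → ∀ (c : PBond (F.P K) (j + 1)) (i : Idx (F.P K)), ‖loopM (coeField (Averaging.iter (avOfRecord F N K) j U₀)) c i - 1‖ ≤ εs j)
    (hε50 : ∀ j, j < k → εs j ≤ 1 / 50) (hNε : ∀ j, j < k → (N : ℝ) * εs j ≤ 2) (hεsum : 300000 * (Finset.range k).sum εs ≤ 1 / 4)
    {Y : PBond (F.P K) 0 → Matrix (Fin N) (Fin N) ℂ} (hY : ∀ b, (Y b).trace = 0) (hsmall : (F.L : ℝ) ^ k * ‖Y‖ < 1 / (25000000000 * (F.L : ℝ) * N)) :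
    (∀ j, j < k → ∀ (c : PBond (F.P K) (j + 1)) (i : Idx (F.P K)), ‖loopMh (iterMh j (expOver U₀ Y)) c i - 1‖ ≤ 1 / 2) ∧
    (∀ c : PBond (F.P K) k, ‖iterMh k (expOver U₀ Y) c * star ((Averaging.iter (fun j => blockAvg (P := F.P K) (j := j) expMeanLogSU) k U₀ c : SU N) : Matrix (Fin N) (Fin N) ℂ) - 1‖
      ≤ 8000 * ((F.L : ℝ) ^ k * ‖Y‖)) := by
  have hN1 : (1 : ℝ) ≤ N := by exact_mod_cast Nat.one_le_iff_ne_zero.2 (NeZero.ne N)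
  have hL12 : (12 : ℝ) ≤ F.L := by exact_mod_cast F.hL11
  have hd4 : ((F.P K).d : ℝ) = 4 := by rw [T4Family.P_d]; norm_num
  have hPL : ((F.P K).L : ℝ) = F.L := by rw [T4Family.P_L]
  have hLN : 0 < (F.L : ℝ) * N := by positivity
  set ρ₀ : ℝ := 1 / (25000000000 * (F.L : ℝ) * N) with hρ₀
  have hρ₀LN : ρ₀ * ((F.L : ℝ) * N) = 1 / 25000000000 := by rw [hρ₀]; field_simp
  have hY0 : 0 ≤ (F.L : ℝ) ^ k * ‖Y‖ := by positivity
  have hNρ : (N : ℝ) * ((F.L : ℝ) ^ k * ‖Y‖) ≤ 1 / 25000000000 := by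
    have h1 : (N : ℝ) * ((F.L : ℝ) ^ k * ‖Y‖) ≤ N * ρ₀ := mul_le_mul_of_nonneg_left hsmall.le (by positivity)
    have h2 : (N : ℝ) * ρ₀ * 1 ≤ (N : ℝ) * ρ₀ * F.L := mul_le_mul_of_nonneg_left (by linarith) (by positivity)
    linarith
  have hLρ : (F.L : ℝ) * ((F.L : ℝ) ^ k * ‖Y‖) ≤ 1 / 25000000000 := by
    have h1 : (F.L : ℝ) * ((F.L : ℝ) ^ k * ‖Y‖) ≤ F.L * ρ₀ := mul_le_mul_of_nonneg_left hsmall.le (by positivity)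
    have h2 : (F.L : ℝ) * ρ₀ * 1 ≤ (F.L : ℝ) * ρ₀ * N := mul_le_mul_of_nonneg_left hN1 (by positivity)
    linarith
  have hs : 12 * ((F.L : ℝ) ^ k * ‖Y‖) ≤ 1 / 25000000000 := (mul_le_mul_of_nonneg_right hL12 hY0).trans hLρ
  have hρ' : 8 * (((F.P K).d : ℝ) + 1) * (((F.P K).L : ℝ) ^ k * (2 * ‖Y‖)) ≤ 1 / 10 ^ 6 := by
    rw [hd4, hPL]; linarith
  have hQ' : 2 * (20000000 * (((F.P K).d : ℝ) + 1) ^ 2 * (F.P K).L) * (((F.P K).L : ℝ) ^ k * (2 * ‖Y‖)) + (60000 * (((F.P K).d : ℝ) + 1)) * (Finset.range k).sum εs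
      ≤ 1 / 2 := by
    rw [hd4, hPL]; linarith
  have hN' : ∀ j, j < k → (N : ℝ) * (56 * (((F.P K).d : ℝ) + 1) * (((F.P K).L : ℝ) ^ k * (2 * ‖Y‖)) + εs j) ≤ 3 := by
    intro j hj; rw [hd4, hPL]; linarith [hNε j hj]
  refine ⟨fun j hj c i => norm_loopMh_iterMh_expOver_sub_one_le U₀ k hU₀ εs hε0 hε hε50 hY hρ' hQ' hN' hj c i, fun c => ?_⟩
  have h := norm_iterMh_expOver_mul_star_sub_one_le U₀ k hU₀ εs hε0 hε hε50 hY hρ' hQ' hN' c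
  rw [hd4, hPL] at h
  linarith

/-- ★ **THE FRAMED RELATIVE AVERAGE IS NEAR `1` ON THE POLYDISC**: `‖Ū^{pr}(e^{iY}U₀)(c)·Ū₀(c)⋆ − 1‖ ≤ 2·10⁴·L^k‖Y‖` for traceless `Y` with `L^k‖Y‖ < (2.5·10¹⁰·L·N)⁻¹`, from the
package (`δ = 8000·L^k‖Y‖`) and the DISPLAYED frame bound `‖h(e^{iY}U₀) − 1‖, ‖h⁻¹(e^{iY}U₀) − 1‖ ≤ c_𝔥·L^k‖Y‖` with `c_𝔥 ≤ 10³` (✓`norm_avPrM_mul_star_sub_one_le`,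
`(1+θ)(1+δ)(1+θ) − 1 ≤ 2(2θ+δ)`). [cite: Balaban1985Averaging, (92) p.31, Proposition 3 p.36; Balaban1985Variational, (51)–(53) p.286] -/
theorem norm_avPrM_expOver_mul_star_sub_one_le_of_loopProfile (𝔥 : FrameDatum (F.P K) N k U₀) (hU₀ : SmallBelow (avOfRecord F N K) k U₀)
    (εs : ℕ → ℝ) (hε0 : ∀ j, 0 ≤ εs j)
    (hε : ∀ j, j < k → ∀ (c : PBond (F.P K) (j + 1)) (i : Idx (F.P K)), ‖loopM (coeField (Averaging.iter (avOfRecord F N K) j U₀)) c i - 1‖ ≤ εs j)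
    (hε50 : ∀ j, j < k → εs j ≤ 1 / 50) (hNε : ∀ j, j < k → (N : ℝ) * εs j ≤ 2) (hεsum : 300000 * (Finset.range k).sum εs ≤ 1 / 4)
    {c𝔥 : ℝ} (hc : c𝔥 ≤ 1000)
    (hnear : ∀ Y : PBond (F.P K) 0 → Matrix (Fin N) (Fin N) ℂ, (∀ b, (Y b).trace = 0) → (F.L : ℝ) ^ k * ‖Y‖ < 1 / (25000000000 * (F.L : ℝ) * N) →
      ∀ y : Site (F.P K) k, ‖𝔥.map (expOver U₀ Y) y - 1‖ ≤ c𝔥 * ((F.L : ℝ) ^ k * ‖Y‖) ∧ ‖𝔥.inv (expOver U₀ Y) y - 1‖ ≤ c𝔥 * ((F.L : ℝ) ^ k * ‖Y‖))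
    {Y : PBond (F.P K) 0 → Matrix (Fin N) (Fin N) ℂ} (hY : ∀ b, (Y b).trace = 0) (hsmall : (F.L : ℝ) ^ k * ‖Y‖ < 1 / (25000000000 * (F.L : ℝ) * N))
    (c : PBond (F.P K) k) :
    ‖avPrM 𝔥 (expOver U₀ Y) c * star ((Averaging.iter (fun j => blockAvg (P := F.P K) (j := j) expMeanLogSU) k U₀ c : SU N) : Matrix (Fin N) (Fin N) ℂ) - 1‖ ≤ 20000 * ((F.L : ℝ) ^ k * ‖Y‖) := by
  have hN1 : (1 : ℝ) ≤ N := by exact_mod_cast Nat.one_le_iff_ne_zero.2 (NeZero.ne N)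
  have hL12 : (12 : ℝ) ≤ F.L := by exact_mod_cast F.hL11
  have hLN1 : (1 : ℝ) ≤ (F.L : ℝ) * N := one_le_mul_of_one_le_of_one_le (by linarith) hN1
  have hρ₀le : 1 / (25000000000 * (F.L : ℝ) * N) ≤ 1 / 25000000000 :=
    one_div_le_one_div_of_le (by norm_num) (by linarith [mul_le_mul_of_nonneg_left hLN1 (by norm_num : (0:ℝ) ≤ 25000000000)])
  obtain ⟨-, hl⟩ := polydiscPackage_of_loopProfile F N k U₀ hU₀ εs hε0 hε hε50 hNε hεsum hY hsmall
  have hmi := hnear Y hY hsmall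
  have hs0 : 0 ≤ (F.L : ℝ) ^ k * ‖Y‖ := by positivity
  have hθ : 0 ≤ c𝔥 * ((F.L : ℝ) ^ k * ‖Y‖) := (norm_nonneg _).trans (hmi c.src).1
  have hθle : c𝔥 * ((F.L : ℝ) ^ k * ‖Y‖) ≤ 1000 * ((F.L : ℝ) ^ k * ‖Y‖) := mul_le_mul_of_nonneg_right hc hs0
  have hσ : c𝔥 * ((F.L : ℝ) ^ k * ‖Y‖) + 8000 * ((F.L : ℝ) ^ k * ‖Y‖) + c𝔥 * ((F.L : ℝ) ^ k * ‖Y‖) ≤ 1 := by linarith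
  have hp := prod3_sub_one_le_two_mul hθ (by positivity : (0:ℝ) ≤ 8000 * ((F.L : ℝ) ^ k * ‖Y‖)) hθ hσ
  refine (norm_avPrM_mul_star_sub_one_le 𝔥 (expOver U₀ Y) c (hmi c.src).1 (hmi c.tgt).2 (hl c)).trans ?_
  linarith

/-- ★★★ **THE FRAMED (44) AT THE RECORD — `Prop4LetterCPrAtRecord … 𝔥 levB (3.2·10¹⁶·L·N) ((2·10¹¹·L·N)⁻¹)` from the loop profile of the real tower (F5's hypotheses VERBATIM) and TWO
DISPLAYED frame bounds on the traceless scaled polydisc `L^k‖Y‖ < ρ₀ = (2.5·10¹⁰·L·N)⁻¹`**: the chart field lies in the frame's window (`hdom`) and the frame and its inverse are within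
`c_𝔥·L^k‖Y‖` of `1` there, `c_𝔥 ≤ 10³` (`hnear`; def-Y's near-one token in the scaled currency).  Proof = F5 re-run: the package ⊗ the frame bounds give
`‖Ū^{pr}Ū₀⋆ − 1‖ ≤ 2·10⁴·L^k‖Y‖`, hence the linear bound `4·10⁴·L^k‖Y‖` on the framed log-chart and its analyticity; the framed line estimate
✓`norm_framedLogChart_sub_qPrCplxOp_le_of_linearBound` closes with `C₂ = 8·4·10⁴∕ρ₀ = 8·10¹⁵·L·N` against `(L^k‖X‖)² ≤ 4‖A′‖²`.
[cite: Balaban1985Variational, (44) p.285, Prop. 4 (97)–(98) pp.292–293, (51)–(53) p.286; Balaban1985Averaging, (92) p.31, Proposition 3 p.36; Balaban1987RG1, (0.8) p.253] -/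
theorem prop4LetterCPrAtRecord_of_loopProfile [Fact (0 < (F.L : ℝ))] [Fact (0 < (F.P K).eta k)] [Fact (0 < c0Rec F K k)] [Fact (∀ c, 0 < wBRec F K k c)]
    (𝔥 : FrameDatum (F.P K) N k U₀) (levB : PBond (F.P K) k → ℕ) (hU₀ : SmallBelow (avOfRecord F N K) k U₀) (hΩ : ∀ x, x ∈ Ω k)
    (εs : ℕ → ℝ) (hε0 : ∀ j, 0 ≤ εs j)
    (hε : ∀ j, j < k → ∀ (c : PBond (F.P K) (j + 1)) (i : Idx (F.P K)), ‖loopM (coeField (Averaging.iter (avOfRecord F N K) j U₀)) c i - 1‖ ≤ εs j)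
    (hε50 : ∀ j, j < k → εs j ≤ 1 / 50) (hNε : ∀ j, j < k → (N : ℝ) * εs j ≤ 2) (hεsum : 300000 * (Finset.range k).sum εs ≤ 1 / 4)
    {c𝔥 : ℝ} (hc : c𝔥 ≤ 1000)
    (hdom : ∀ Y : PBond (F.P K) 0 → Matrix (Fin N) (Fin N) ℂ, (∀ b, (Y b).trace = 0) → (F.L : ℝ) ^ k * ‖Y‖ < 1 / (25000000000 * (F.L : ℝ) * N) →
      expOver U₀ Y ∈ 𝔥.dom)
    (hnear : ∀ Y : PBond (F.P K) 0 → Matrix (Fin N) (Fin N) ℂ, (∀ b, (Y b).trace = 0) → (F.L : ℝ) ^ k * ‖Y‖ < 1 / (25000000000 * (F.L : ℝ) * N) →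
      ∀ y : Site (F.P K) k, ‖𝔥.map (expOver U₀ Y) y - 1‖ ≤ c𝔥 * ((F.L : ℝ) ^ k * ‖Y‖) ∧ ‖𝔥.inv (expOver U₀ Y) y - 1‖ ≤ c𝔥 * ((F.L : ℝ) ^ k * ‖Y‖)) :
    Prop4LetterCPrAtRecord F N K k Ω U₀ 𝔥 levB (32000000000000000 * (F.L : ℝ) * N) (1 / (200000000000 * (F.L : ℝ) * N)) := by
  -- constants and casts (as in F5)
  have hN1 : (1 : ℝ) ≤ N := by exact_mod_cast Nat.one_le_iff_ne_zero.2 (NeZero.ne N)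
  have hL12 : (12 : ℝ) ≤ F.L := by exact_mod_cast F.hL11
  have hPL : ((F.P K).L : ℝ) = F.L := by rw [T4Family.P_L]
  have hLN : 0 < (F.L : ℝ) * N := by positivity
  have hLN1 : (1 : ℝ) ≤ (F.L : ℝ) * N := one_le_mul_of_one_le_of_one_le (by linarith) hN1
  set ρ₀ : ℝ := 1 / (25000000000 * (F.L : ℝ) * N) with hρ₀
  have hρ₀pos : 0 < ρ₀ := by positivity
  have hρ₀le : ρ₀ ≤ 1 / 25000000000 := by
    rw [hρ₀]
    exact one_div_le_one_div_of_le (by norm_num) (by linarith [mul_le_mul_of_nonneg_left hLN1 (by norm_num : (0:ℝ) ≤ 25000000000)])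
  have hc₄' : 1 / (200000000000 * (F.L : ℝ) * N) = ρ₀ / 8 := by
    rw [hρ₀, div_div]; congr 1; ring
  -- the framed chart is analytic with the linear bound `4·10⁴·L^k‖Y‖` on the traceless scaled polydisc
  have hdiff : ∀ Y : PBond (F.P K) 0 → Matrix (Fin N) (Fin N) ℂ, (∀ b, (Y b).trace = 0) → ((F.P K).L : ℝ) ^ k * ‖Y‖ < ρ₀ →
      DifferentiableAt ℂ (fun Y : PBond (F.P K) 0 → Matrix (Fin N) (Fin N) ℂ =>
        logOver (coeField (Averaging.iter (fun j => blockAvg (P := F.P K) (j := j) expMeanLogSU) k U₀)) (avPrM 𝔥 (expOver U₀ Y))) Y := by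
    intro Y hY hsmall
    rw [hPL] at hsmall
    obtain ⟨hp, -⟩ := polydiscPackage_of_loopProfile F N k U₀ hU₀ εs hε0 hε hε50 hNε hεsum hY hsmall
    refine (analyticAt_framedLogChart 𝔥 (hdom Y hY hsmall) (fun j hj c i => lt_of_le_of_lt (hp j hj c i) (by norm_num)) fun c =>
      lt_of_le_of_lt (norm_avPrM_expOver_mul_star_sub_one_le_of_loopProfile F N k U₀ 𝔥 hU₀ εs hε0 hε hε50 hNε hεsum hc hnear hY hsmall c) ?_).differentiableAt
    linarith
  have hbound : ∀ Y : PBond (F.P K) 0 → Matrix (Fin N) (Fin N) ℂ, (∀ b, (Y b).trace = 0) → ((F.P K).L : ℝ) ^ k * ‖Y‖ < ρ₀ →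
      ‖logOver (coeField (Averaging.iter (fun j => blockAvg (P := F.P K) (j := j) expMeanLogSU) k U₀)) (avPrM 𝔥 (expOver U₀ Y))‖ ≤ 40000 * (((F.P K).L : ℝ) ^ k * ‖Y‖) := by
    intro Y hY hsmall
    rw [hPL] at hsmall ⊢
    have hY0 : 0 ≤ (F.L : ℝ) ^ k * ‖Y‖ := by positivity
    have h := norm_logOver_le_two_mul' U₀ k (by positivity) (by linarith)
      (norm_avPrM_expOver_mul_star_sub_one_le_of_loopProfile F N k U₀ 𝔥 hU₀ εs hε0 hε hε50 hNε hεsum hc hnear hY hsmall)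
    linarith
  refine ⟨fun A hA => ?_, fun A hA => ?_⟩
  · -- the quadratic bound
    have hA0 := norm_nonneg A
    set X : PBond (F.P K) 0 → Matrix (Fin N) (Fin N) ℂ := ((((F.P K).eta k : ℝ) : ℂ)) • evLit F N K k Ω U₀ (slProjLit F N K k Ω U₀ A) with hX
    have hXtr : ∀ b, (X b).trace = 0 := fun b => by
      rw [hX, Pi.smul_apply, Matrix.trace_smul, evLit_apply, trace_equiv_slProjLit (F := F) (N := N) (K := K) (k := k) (Ω := Ω) (U₀ := U₀) A _, smul_zero]
    have hXn : (F.L : ℝ) ^ k * ‖X‖ ≤ 2 * ‖A‖ := norm_scaled_evLit_slProjLit_le F N k Ω U₀ hΩ A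
    have hc₄ : 2 * (1 / (200000000000 * (F.L : ℝ) * N)) ≤ ρ₀ / 4 := by rw [hc₄']; linarith
    have hXρ : 4 * (((F.P K).L : ℝ) ^ k * ‖X‖) ≤ ρ₀ := by rw [hPL]; linarith
    have hmain := norm_framedLogChart_sub_qPrCplxOp_le_of_linearBound 𝔥 hU₀ (by norm_num : (0:ℝ) ≤ 40000) hdiff hbound hXtr hXρ
    rw [hPL] at hmain
    have hC : 8 * 40000 / ρ₀ * ((F.L : ℝ) ^ k * ‖X‖) ^ 2 ≤ 32000000000000000 * (F.L : ℝ) * N * ‖A‖ ^ 2 := by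
      have h1 : ((F.L : ℝ) ^ k * ‖X‖) ^ 2 ≤ (2 * ‖A‖) ^ 2 := pow_le_pow_left₀ (by positivity) hXn 2
      have h2 : 8 * 40000 / ρ₀ = 1280000 * (25000000000 * (F.L : ℝ) * N) / 4 := by rw [hρ₀]; field_simp; ring
      rw [h2]
      calc 1280000 * (25000000000 * (F.L : ℝ) * N) / 4 * ((F.L : ℝ) ^ k * ‖X‖) ^ 2
          ≤ 1280000 * (25000000000 * (F.L : ℝ) * N) / 4 * (2 * ‖A‖) ^ 2 := mul_le_mul_of_nonneg_left h1 (by positivity)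
        _ = 32000000000000000 * (F.L : ℝ) * N * ‖A‖ ^ 2 := by ring
    refine (NegSup.norm_le_iff (by positivity)).2 fun c => ?_
    rw [levWeight_apply, pow_zero, one_mul, equiv_CslprOfRecord_eq F N k Ω U₀ 𝔥 levB A c]
    exact (norm_le_pi_norm _ c).trans (hmain.trans hC)
  · -- differentiability on the ball: `C^{sl,pr} = C^{pr} ∘ P` is analytic at `A′`
    have hXn : (F.L : ℝ) ^ k * ‖((((F.P K).eta k : ℝ) : ℂ)) • evLit F N K k Ω U₀ (slProjLit F N K k Ω U₀ A)‖ ≤ 2 * ‖A‖ := norm_scaled_evLit_slProjLit_le F N k Ω U₀ hΩ A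
    have hXtr : ∀ b, ((((((F.P K).eta k : ℝ) : ℂ)) • evLit F N K k Ω U₀ (slProjLit F N K k Ω U₀ A)) b).trace = 0 := fun b => by
      rw [Pi.smul_apply, Matrix.trace_smul, evLit_apply, trace_equiv_slProjLit (F := F) (N := N) (K := K) (k := k) (Ω := Ω) (U₀ := U₀) A _, smul_zero]
    have hsmall : (F.L : ℝ) ^ k * ‖((((F.P K).eta k : ℝ) : ℂ)) • evLit F N K k Ω U₀ (slProjLit F N K k Ω U₀ A)‖ < ρ₀ := by
      have hA' : ‖A‖ < 1 / (200000000000 * (F.L : ℝ) * N) := hA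
      have : 2 * (1 / (200000000000 * (F.L : ℝ) * N)) ≤ ρ₀ := by rw [hc₄']; linarith
      linarith
    obtain ⟨hp, -⟩ := polydiscPackage_of_loopProfile F N k U₀ hU₀ εs hε0 hε hε50 hNε hεsum hXtr hsmall
    have han : AnalyticAt ℂ (CprOfRecord F N K k Ω U₀ 𝔥 levB) (slProjLit F N K k Ω U₀ A) :=
      analyticAt_CprOfRecord F N K k Ω U₀ 𝔥 levB _ (hdom _ hXtr hsmall) (fun j hj c i => lt_of_le_of_lt (hp j hj c i) (by norm_num)) fun c =>
        lt_of_le_of_lt (norm_avPrM_expOver_mul_star_sub_one_le_of_loopProfile F N k U₀ 𝔥 hU₀ εs hε0 hε hε50 hNε hεsum hc hnear hXtr hsmall c) (by linarith)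
    exact (han.comp ((slProjLit F N K k Ω U₀).analyticAt A)).differentiableAt.differentiableWithinAt

end RecordPr

end Summit.QuantumFields.YangMills.Theorems.C44IterMh

end
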